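import Summits.ValiantsHypothesis.ValiantsHypothesis.Theorems.LacunarySymmetroidMatrixDescartesCensusDoorA34SheetHyperbolicPencil

/-!
# `MatrixDescartes` census — DOOR A at `(3,4)`: the FLAG PARITY LAW of the hyperbolic cell — where the middle window carries the sign of a rank-one
# compression at a middle-type root and at a top-window root, it has an EVEN number of sign changes between them

HONEST FRAMING.  Object-search cell `pub-symmetroid`, engine seat `val-sym-eng-2` (g7); helper row beside the registered strata line
`Cruxes/DoorA34/Lines/strata.lean` on stmt-ValiantsHypothesis-19980 (`DoorA34 = PosRootLawAt 3 4 18`: OPEN, typed, never asserted here), stub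
`stub_nullTopCeiling`, INDEFINITE cell; the exact sign skeleton of regime (0) («near rank one») of the seat's INDEFINITE WINDOW LAW (report
HOME/DOOR-A34-ENG2G7-REPORT.md §2; crux note `Cruxes/DoorA34/Lines/strata-indefinite-window.md`).  Pencil `F(x) = Σ_{l<4} x^{d_l}S_l`, symmetric letters,
`S₃ = h·(vwᵀ + wvᵀ)`, core `G(x)`, `k = v × w`, `q_v(x) = vᵀadj G(x) v`, middle form `m(x) = vᵀadj G(x) w`, top trinomial `T(x) = kᵀG(x)k`:

* `hyperbolic_flag_parity_law` — **FLAG PARITY LAW.**  Let `r` be a det-root of `F` of TYPE `(−)` and `z` a root of the top trinomial (`k ≠ 0`).  If the middle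
  form has the STRICT SIGN OF `q_v` at both points (`m(r)·q_v(r) > 0`, `m(z)·q_v(z) > 0` — the near-rank-one regime, where `m = q_v + O(∠(v,w))`), then
  `m(r) < 0`, `m(z) < 0` and `0 < m(r)·m(z)`: the middle window changes sign an EVEN number of times between a middle-type root and a top-window root.
  So an odd middle count `γ_M` followed by a top-window root is impossible in that regime — the rank-two form of the FLAG LAW («`(5, ≥1)` impossible»,
  p505503), whose window consequence is `≤ 9 + 1 + 4 + 1 + 2 = 17`.
* `hyperbolic_flag_parity_law_w` — the same with `q_w`.

Ingredients: the pencil TYPE LAW (`q_v(r) ≤ 0` at a type-`(−)` root) and ISOTROPY LAW (`q_v(z) ≤ 0` at a top root) of …SheetHyperbolicPencil.  The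
regime hypothesis (same strict sign) is what the located law supplies perturbatively; nothing here bounds the count; `DoorA34` and the three stubs stay
OPEN; nothing on `MatrixDescartes` (stmt-ValiantsHypothesis-18050) or `VP ≠ VNP` — VP≠VNP not moved.  [folklore] elementary sign bookkeeping.
-/

-- `Summit.ValiantsHypothesis.ValiantsHypothesis.…` repeats a component by the D-0017 layout
-- (single-conjunct summit), which the `dupNamespace` linter flags; the name is mandated.
set_option linter.dupNamespace false

namespace Summit.ValiantsHypothesis.ValiantsHypothesis.Theorems.LacunarySymmetroidMatrixDescartes.Census

open Polynomial Finset
open scoped BigOperators Polynomial Matrix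
open Matrix

/-- Elementary: `q ≤ 0` and `m·q > 0` force `m < 0`. [folklore] -/
theorem neg_of_mul_pos_of_nonpos {m q : ℝ} (hq : q ≤ 0) (h : 0 < m * q) : m < 0 := by
  rcases lt_trichotomy m 0 with hm | hm | hm
  · exact hm
  · rw [hm, zero_mul] at h; exact absurd h (lt_irrefl 0)
  · exfalso; nlinarith

/-- **FLAG PARITY LAW (with `q_v`).**  Symmetric letters, `S₃ = h·(vwᵀ + wvᵀ)`, `k = v × w ≠ 0`; `r` a det-root of type `(−)`, `z` a root of the top
trinomial.  If the middle form `m = vᵀadj(G)w` has the strict sign of `q_v` at `r` and at `z`, then `m(r) < 0`, `m(z) < 0`, and `0 < m(r)·m(z)` — an even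
number of sign changes of the middle window between `r` and `z`. [folklore] -/
theorem hyperbolic_flag_parity_law (d : Fin 4 → ℕ) (S : Fin 4 → Matrix (Fin 3) (Fin 3) ℝ) (hS : ∀ l, (S l).IsSymm)
    (h : ℝ) (v w : Fin 3 → ℝ) (hS3 : S 3 = h • (Matrix.vecMulVec v w + Matrix.vecMulVec w v)) (hk : v ⨯₃ w ≠ 0) {r z : ℝ}
    (hr : (Matrix.det (∑ l, ((X : ℝ[X]) ^ d l) • (S l).map C)).IsRoot r) (htype : (∑ l, r ^ d l • S l).adjugate.trace < 0)
    (hz : (v ⨯₃ w) ⬝ᵥ ((∑ l : Fin 3, z ^ d (Fin.castSucc l) • S (Fin.castSucc l)) *ᵥ (v ⨯₃ w)) = 0)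
    (hsame_r : 0 < (v ⬝ᵥ ((∑ l : Fin 3, r ^ d (Fin.castSucc l) • S (Fin.castSucc l)).adjugate *ᵥ w))
        * (v ⬝ᵥ ((∑ l : Fin 3, r ^ d (Fin.castSucc l) • S (Fin.castSucc l)).adjugate *ᵥ v)))
    (hsame_z : 0 < (v ⬝ᵥ ((∑ l : Fin 3, z ^ d (Fin.castSucc l) • S (Fin.castSucc l)).adjugate *ᵥ w))
        * (v ⬝ᵥ ((∑ l : Fin 3, z ^ d (Fin.castSucc l) • S (Fin.castSucc l)).adjugate *ᵥ v))) :
    v ⬝ᵥ ((∑ l : Fin 3, r ^ d (Fin.castSucc l) • S (Fin.castSucc l)).adjugate *ᵥ w) < 0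
      ∧ v ⬝ᵥ ((∑ l : Fin 3, z ^ d (Fin.castSucc l) • S (Fin.castSucc l)).adjugate *ᵥ w) < 0
      ∧ 0 < (v ⬝ᵥ ((∑ l : Fin 3, r ^ d (Fin.castSucc l) • S (Fin.castSucc l)).adjugate *ᵥ w))
          * (v ⬝ᵥ ((∑ l : Fin 3, z ^ d (Fin.castSucc l) • S (Fin.castSucc l)).adjugate *ᵥ w)) := by
  have hqr := (quadForm_adjugate_core_nonpos_of_type_neg d S hS h v w hS3 hr htype).1
  have hqz := (quadForm_adjugate_core_nonpos_at_top_root d S hS v w hk hz).1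
  have hmr := neg_of_mul_pos_of_nonpos hqr hsame_r
  have hmz := neg_of_mul_pos_of_nonpos hqz hsame_z
  exact ⟨hmr, hmz, mul_pos_of_neg_of_neg hmr hmz⟩

/-- **FLAG PARITY LAW (with `q_w`)**: the same conclusion when the middle form carries the strict sign of `q_w` at `r` and at `z`. [folklore] -/
theorem hyperbolic_flag_parity_law_w (d : Fin 4 → ℕ) (S : Fin 4 → Matrix (Fin 3) (Fin 3) ℝ) (hS : ∀ l, (S l).IsSymm)
    (h : ℝ) (v w : Fin 3 → ℝ) (hS3 : S 3 = h • (Matrix.vecMulVec v w + Matrix.vecMulVec w v)) (hk : v ⨯₃ w ≠ 0) {r z : ℝ}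
    (hr : (Matrix.det (∑ l, ((X : ℝ[X]) ^ d l) • (S l).map C)).IsRoot r) (htype : (∑ l, r ^ d l • S l).adjugate.trace < 0)
    (hz : (v ⨯₃ w) ⬝ᵥ ((∑ l : Fin 3, z ^ d (Fin.castSucc l) • S (Fin.castSucc l)) *ᵥ (v ⨯₃ w)) = 0)
    (hsame_r : 0 < (v ⬝ᵥ ((∑ l : Fin 3, r ^ d (Fin.castSucc l) • S (Fin.castSucc l)).adjugate *ᵥ w))
        * (w ⬝ᵥ ((∑ l : Fin 3, r ^ d (Fin.castSucc l) • S (Fin.castSucc l)).adjugate *ᵥ w)))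
    (hsame_z : 0 < (v ⬝ᵥ ((∑ l : Fin 3, z ^ d (Fin.castSucc l) • S (Fin.castSucc l)).adjugate *ᵥ w))
        * (w ⬝ᵥ ((∑ l : Fin 3, z ^ d (Fin.castSucc l) • S (Fin.castSucc l)).adjugate *ᵥ w))) :
    0 < (v ⬝ᵥ ((∑ l : Fin 3, r ^ d (Fin.castSucc l) • S (Fin.castSucc l)).adjugate *ᵥ w))
          * (v ⬝ᵥ ((∑ l : Fin 3, z ^ d (Fin.castSucc l) • S (Fin.castSucc l)).adjugate *ᵥ w)) := by
  have hqr := (quadForm_adjugate_core_nonpos_of_type_neg d S hS h v w hS3 hr htype).2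
  have hqz := (quadForm_adjugate_core_nonpos_at_top_root d S hS v w hk hz).2
  exact mul_pos_of_neg_of_neg (neg_of_mul_pos_of_nonpos hqr hsame_r) (neg_of_mul_pos_of_nonpos hqz hsame_z)

end Summit.ValiantsHypothesis.ValiantsHypothesis.Theorems.LacunarySymmetroidMatrixDescartes.Census
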